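import Mathlib
import HarnessLib
import Summits.NavierStokesRegularity.NavierStokesRegularity.Theorems.PoloidalWindowDoorLrcModEntireJetCertFast2
import Summits.NavierStokesRegularity.NavierStokesRegularity.Theorems.PoloidalWindowDoorLrcModEntireJetLetters

/-!
# Route `PoloidalWindowDoor`, item `LrcModEntire` (stmt-NavierStokesRegularity-20428) — certificate checker: RELABELING A LOCAL DATUM
# (new jet letters = polynomials in the old ones; tables, laws and pins transferred by old-checker certificates)

Cell ns-regularity-ideate, seat ns-poloidal-K2-p3 gen 8 (LEAD of item 20428; `--supports stmt-NavierStokesRegularity-20428`; definitions reviewed).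
Generic calculus, no Navier–Stokes content.  Kernel-port lane of DIRECTOR-NS #81 (1)(b): the exact-elimination engines (cert-1 B's slice engine, the
Gröbner lane) work in COMPLEX SLICE LETTERS `f_ab, w_ab, μ_j` (Taylor coefficients in `ζ = x + iy` on the slice, `z`-derivatives eliminated by the
kinematic laws); the tree's (TH) datum `…THCertFast.thLocalDatum` is written in the Cartesian jet letters `∂ₜ^a∂ₓ^b∂ᵧ^c∂_z^d uᵢ`.  Converting the engines'
laws into Cartesian letters multiplies their sizes by 6–15 at weights 6–8 (seat measurement 2026-08-28), which the native lane cannot absorb; the remedy is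
to CHANGE LETTERS INSIDE THE KERNEL once and for all.  This file is that change, abstractly:

* `monoSub`, `compQ m T P` — substitution of the polynomials `T 0, …, T (m−1)` (old letters) for the variables of a term list `P` in `m` new letters;
  `ev_compQ` : `ev n (compQ m T P) z = ev m P (subPoint m T z)` where `subPoint m T z = (ev n (T a) z)_{a<m}`.
* `RelabelData` — new tables `S'` / mask `M'` (as lists indexed `[direction][letter]`), new hypothesis laws, new pins with, for every transferred
  item, an OLD-checker certificate (`certCheckS` steps + index): the table identity `D_j(T a) − (S' j a)∘T`, each new law `h'∘T`, and for each new pin a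
  pin-monomial `e` with `π'∘T − pins^e` — all must be DERIVED LAWS of the old hypotheses; `relabelCheck` is the Boolean test.
* `LocalDatum.relabel` — SOUNDNESS: `relabelCheck … = true` and `LocalDatum n S M v hyps pins` give `LocalDatum m S' M' v hyps' pins'` (same open set and
  base point; new jet map `x ↦ subPoint m T (g x)`; tables by the masked chain rule `fderiv_ev_eq_ev_tderiv_masked` + the certificate; laws and pins likewise).

So a certificate may be CHECKED in any letter system reachable from the registered one by certified polynomial relabeling — e.g. the complex slice letters
(next file of the lane).  WHAT THIS IS NOT: not a claim about Navier–Stokes and not a certificate.  References: as in `…JetCertDefs` (Ritt 1950, Olver 1986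
§2.3). [folklore]
-/

noncomputable section

-- the summit and its single sub-problem share the name (CONVENTIONS §1), as in every Theorems file
set_option linter.dupNamespace false

namespace Summit.NavierStokesRegularity.NavierStokesRegularity.Theorems.PoloidalWindowDoorLrcModEntireJetCertRelabel

open _root_.Topology _root_.Filter Set
open Literature.Analysis.ValidatedNumerics Literature.Analysis.ValidatedNumerics.QMvPoly
open Literature.Analysis.Calculus.MvPoly
open Summit.NavierStokesRegularity.NavierStokesRegularity.Theorems.PoloidalWindowDoorLrcModEntireJetCertDefs
open Summit.NavierStokesRegularity.NavierStokesRegularity.Theorems.PoloidalWindowDoorLrcModEntireJetCertMasked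
open Summit.NavierStokesRegularity.NavierStokesRegularity.Theorems.PoloidalWindowDoorLrcModEntireJetCertTree
open Summit.NavierStokesRegularity.NavierStokesRegularity.Theorems.PoloidalWindowDoorLrcModEntireJetCertFast2
open Summit.NavierStokesRegularity.NavierStokesRegularity.Theorems.PoloidalWindowDoorLrcModEntireJetLetters

variable {E : Type*} [NormedAddCommGroup E] [NormedSpace ℝ E] {n : ℕ}

/-! ### Substitution of polynomials for letters -/

/-- `monoSub T k exps = Π_{a<k} (T a)^(exps_a)` (missing exponents read as `0`). [folklore] -/
def monoSub (T : ℕ → QMvPoly) : ℕ → List ℕ → QMvPoly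
  | 0, _ => QMvPoly.const 1
  | k + 1, exps => QMvPoly.mul (monoSub T k exps) (powQ (T k) (exps.getD k 0))

/-- Value of `monoSub`. [folklore] -/
theorem ev_monoSub (T : ℕ → QMvPoly) (z : EuclideanSpace ℝ (Fin n)) (exps : List ℕ) :
    ∀ k, ev n (monoSub T k exps) z = ∏ a ∈ Finset.range k, ev n (T a) z ^ exps.getD a 0 := by
  intro k
  induction k with
  | zero => simp [monoSub, ev, QMvPoly.toMv_const, toFun_apply]
  | succ k ih => rw [monoSub, ev_mul, ih, ev_powQ, Finset.prod_range_succ]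

/-- `compQ m T P`: the term list `P` in `m` letters with the letter `a` replaced by the term list `T a` (`a < m`). [folklore] -/
def compQ (m : ℕ) (T : ℕ → QMvPoly) : QMvPoly → QMvPoly
  | [] => []
  | t :: q => QMvPoly.smul t.2 (monoSub T m t.1) ++ compQ m T q

/-- The point of `ℝᵐ` with coordinates `(T a)(z)`. [folklore] -/
def subPoint (m : ℕ) (T : ℕ → QMvPoly) (z : EuclideanSpace ℝ (Fin n)) : EuclideanSpace ℝ (Fin m) :=
  mkJet (fun (a : Fin m) (w : EuclideanSpace ℝ (Fin n)) => ev n (T a) w) z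

/-- Coordinates of `subPoint`. [folklore] -/
@[simp] theorem subPoint_apply (m : ℕ) (T : ℕ → QMvPoly) (z : EuclideanSpace ℝ (Fin n)) (a : Fin m) :
    subPoint m T z a = ev n (T a) z := by
  simp [subPoint]

/-- **SUBSTITUTION COMMUTES WITH EVALUATION**: `(P∘T)(z) = P((T a)(z))_a`. [folklore] -/
theorem ev_compQ (m : ℕ) (T : ℕ → QMvPoly) (z : EuclideanSpace ℝ (Fin n)) :
    ∀ P : QMvPoly, ev n (compQ m T P) z = ev m P (subPoint m T z) := by
  intro P
  induction P with
  | nil => simp [compQ]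
  | cons t q ih =>
    rw [compQ, ev_append, ev_smul, ev_monoSub, ih]
    conv_rhs => rw [ev, toFun_apply, QMvPoly.eval_toMv_cons]
    rw [ev, toFun_apply, ← Fin.prod_univ_eq_prod_range (fun a => ev n (T a) z ^ t.1.getD a 0) m]
    simp only [subPoint_apply]

/-! ### Relabeling data and its Boolean check -/

/-- One old-checker certificate: derivation steps and the index of the law it certifies. [folklore] -/
abbrev Chunk : Type := List (List (QMvPoly × ℕ × List ℕ)) × ℕ

/-- **RELABELING DATA**: `m` new letters `T a` (polynomials in the `n` old letters), new tables / mask as lists `[j][a]`, new laws and pins,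
and the certificates transferring them (see `relabelCheck`). [folklore] -/
structure RelabelData where
  /-- number of new letters -/
  m : ℕ
  /-- the new letters as polynomials in the old letters (`a`-th entry; missing entries read as `[]`) -/
  T : List QMvPoly
  /-- new tables: `S'[j][a]` = the derivative of new letter `a` along direction `j`, as a polynomial in the NEW letters -/
  S' : List (List QMvPoly)
  /-- new mask: `M'[j][a]` (missing entries read as `false`) -/
  M' : List (List Bool)
  /-- certificates of the table identities `D_j (T a) − (S' j a)∘T` (indexed `[j][a]`) -/
  tab : List (List Chunk)
  /-- new hypothesis laws (in the new letters) -/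
  hyps' : List QMvPoly
  /-- certificates of `h'∘T` for the new laws -/
  hyp : List Chunk
  /-- new pins (in the new letters) -/
  pins' : List QMvPoly
  /-- for each new pin: an exponent vector `e` over the old pins and a certificate of `π'∘T − pins^e` -/
  pin : List (List ℕ × Chunk)

namespace RelabelData

/-- The new letters as a function. [folklore] -/
def Tf (R : RelabelData) : ℕ → QMvPoly := fun a => R.T.getD a []
/-- The new tables as a function. [folklore] -/
def Sf (R : RelabelData) : ℕ → ℕ → QMvPoly := fun j a => (R.S'.getD j []).getD a []
/-- The new mask as a function. [folklore] -/
def Mf (R : RelabelData) : ℕ → ℕ → Bool := fun j a => (R.M'.getD j []).getD a false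

end RelabelData

/-- The difference `p − q` as a term list. [folklore] -/
def subQ (p q : QMvPoly) : QMvPoly := p ++ QMvPoly.smul (-1) q

/-- `ev (subQ p q) = ev p − ev q`. [folklore] -/
theorem ev_subQ (p q : QMvPoly) (z : EuclideanSpace ℝ (Fin n)) : ev n (subQ p q) z = ev n p z - ev n q z := by
  rw [subQ, ev_append, ev_smul]; push_cast; ring

/-- **THE BOOLEAN CHECK of relabeling data** against old tables `S`, mask `M`, laws `hyps`, pins `pins` (all in `n` old letters):
(tables) for every `j < |M'|` and `a < m` with `M' j a`: `T a` uses only letters tabled by `M j`, and the certificate `tab[j][a]` derives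
`D_{S j}(T a) − (S' j a)∘T` from `hyps`; (laws) `hyp[i]` derives `hyps'[i]∘T`; (pins) `pin[i] = (e, c)` with `c` deriving `pins'[i]∘T − pins^e`;
and `|M'|` bounds the directions (`M' j a = false` beyond, by `getD`). [folklore] -/
def relabelCheck (n : ℕ) (S : ℕ → ℕ → QMvPoly) (M : ℕ → ℕ → Bool) (hyps pins : List QMvPoly) (R : RelabelData) : Bool :=
  ((List.range R.M'.length).all fun j =>
    (List.range R.m).all fun a =>
      !(R.Mf j a) ||
        (usesOnlyTabled n (M j) (R.Tf a) &&
          (let c := (R.tab.getD j []).getD a ([], 0)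
           certCheckS n S M hyps c.1 c.2 (subQ (tderiv n (S j) (R.Tf a)) (compQ R.m R.Tf (R.Sf j a))))))
  && ((List.range R.hyps'.length).all fun i =>
        let c := R.hyp.getD i ([], 0)
        certCheckS n S M hyps c.1 c.2 (compQ R.m R.Tf (R.hyps'.getD i [])))
  && (decide (R.pin.length = R.pins'.length) &&
      ((List.range R.pins'.length).all fun i =>
        let ec := R.pin.getD i ([], ([], 0))
        certCheckS n S M hyps ec.2.1 ec.2.2 (subQ (compQ R.m R.Tf (R.pins'.getD i [])) (pinProduct pins ec.1))))

/-! ### Soundness -/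

/-- **RELABELING A LOCAL DATUM.**  If the relabeling data check against the old tables/laws/pins, every local datum for the old system is a local
datum for the new one (same open set and base point; jet map `x ↦ subPoint m T (g x)`). [folklore] -/
theorem LocalDatum.relabel {S : ℕ → ℕ → QMvPoly} {M : ℕ → ℕ → Bool} {v : ℕ → E} {hyps pins : List QMvPoly} (R : RelabelData)
    (hc : relabelCheck n S M hyps pins R = true) (hdat : LocalDatum (E := E) n S M v hyps pins) :
    LocalDatum (E := E) R.m R.Sf R.Mf v R.hyps' R.pins' := by
  obtain ⟨U, p₀, g, hU, hp₀, hg, hS, hhyps, hpins⟩ := hdat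
  simp only [relabelCheck, Bool.and_eq_true, List.all_eq_true, List.mem_range, Bool.or_eq_true, Bool.not_eq_true',
    decide_eq_true_eq] at hc
  obtain ⟨⟨htab, hhyp⟩, hlen, hpin⟩ := hc
  -- the new jet map
  set g' : E → EuclideanSpace ℝ (Fin R.m) := fun x => subPoint R.m R.Tf (g x) with hg'
  have hcoord : ∀ (a : Fin R.m) (x : E), g' x a = ev n (R.Tf a) (g x) := fun a x => by simp [hg']
  have hdiffc : ∀ (p : QMvPoly) (x : E), x ∈ U → DifferentiableAt ℝ (fun y => ev n p (g y)) x := fun p x hx =>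
    ((differentiable_toFun (QMvPoly.toMv ℝ n p)) _).comp x (hg x hx)
  have hg'd : ∀ x ∈ U, DifferentiableAt ℝ g' x := fun x hx => by
    rw [hg']
    exact differentiableAt_mkJet fun a => hdiffc _ x hx
  refine ⟨U, p₀, g', hU, hp₀, hg'd, ?_, ?_, ?_⟩
  · -- tables
    intro j a hM x hx
    have hj : j < R.M'.length := by
      by_contra hj'
      have : R.Mf j a = false := by
        simp [RelabelData.Mf, List.getD_eq_getElem?_getD, List.getElem?_eq_none (not_lt.1 hj')]
      rw [this] at hM; exact Bool.false_ne_true hM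
    have h := htab j hj a a.isLt
    rcases h with h | ⟨huse, hcert⟩
    · rw [h] at hM; exact (Bool.false_ne_true hM).elim
    have hfun : (fun y => g' y a) = fun y => ev n (R.Tf a) (g y) := funext fun y => hcoord a y
    rw [hfun, fderiv_ev_eq_ev_tderiv_masked (hg x hx) (fun i hi => hS j i hi x hx) huse]
    have h0 := ev_eq_zero_of_certCheckS hU hg (hS) hhyps hcert x hx
    rw [ev_subQ, sub_eq_zero] at h0
    rw [h0, ev_compQ]
  · -- laws
    intro L hL x hx
    obtain ⟨i, hi, rfl⟩ := List.getElem_of_mem hL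
    have h := hhyp i hi
    have h0 := ev_eq_zero_of_certCheckS hU hg hS hhyps h x hx
    rw [List.getD_eq_getElem?_getD, List.getElem?_eq_getElem hi, Option.getD_some, ev_compQ] at h0
    simpa [hg'] using h0
  · -- pins
    intro π hπ
    obtain ⟨i, hi, rfl⟩ := List.getElem_of_mem hπ
    have h := hpin i hi
    have h0 := ev_eq_zero_of_certCheckS hU hg hS hhyps h p₀ hp₀
    rw [ev_subQ, sub_eq_zero, List.getD_eq_getElem?_getD, List.getElem?_eq_getElem hi, Option.getD_some, ev_compQ] at h0
    show ev R.m (R.pins'[i]) (subPoint R.m R.Tf (g p₀)) ≠ 0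
    rw [h0]
    exact ev_pinProduct_ne_zero (g p₀) pins _ hpins

/-! ### Self-test of the substitution -/

/-- `(X₀² − 3X₁) ∘ (X₀ ↦ Y₀ + Y₁, X₁ ↦ Y₀Y₁) = Y₀² + 2Y₀Y₁ + Y₁² − 3Y₀Y₁` (normal forms agree; decidable). [folklore] -/
theorem compQ_selfTest :
    normalizeS (subQ
      (compQ 2 (fun a => if a = 0 then QMvPoly.var 2 0 ++ QMvPoly.var 2 1 else QMvPoly.mul (QMvPoly.var 2 0) (QMvPoly.var 2 1))
        [([2, 0], 1), ([0, 1], -3)])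
      (QMvPoly.mul (QMvPoly.var 2 0) (QMvPoly.var 2 0) ++ QMvPoly.smul (-1) (QMvPoly.mul (QMvPoly.var 2 0) (QMvPoly.var 2 1))
        ++ QMvPoly.mul (QMvPoly.var 2 1) (QMvPoly.var 2 1))) = [] := by
  decide +kernel

end Summit.NavierStokesRegularity.NavierStokesRegularity.Theorems.PoloidalWindowDoorLrcModEntireJetCertRelabel

end
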